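/-
Origin: expansion seat `planner-pub-hodgecm-prl2-g3-0`, handover 2026-08-18 (`HOME/pub-hodgecm-prl2-g3/lean/Prl2g3/ReflexInflate.lean`, md5 10f43bf2, 127 lines);
landed by the gen-6 packager in gate run 22 as `HodgeCM/CM/ReflexInflate.lean` (verbatim).
-/
/-
Origin: HOME/pub-hodgecm-prl2-g3/lean/Prl2g3/ReflexInflate.lean — session planner-pub-hodgecm-prl2-g3-0 (unit pub-hodgecm-prl2-g3, gen 3).
Intended final place: `HodgeCM/CM/ReflexInflate.lean` (imports Mathlib + `HodgeCM.CM.Lemmas` only; independent of the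
StubTree files).  KERNEL, Mathlib only: the candidate CM type `Φ(Ψ)` of reading R3 of `HodgeCM.LiuSupplyDatum.Dict`
(REDUCTION-v3 §2) is a genuine CM type of `L` and contains `ι₁` iff `ι₁ ∘ j ∈ Ψ`.  What is NOT claimed: that `Φ(Ψ)` is the
`Φ_μ` of [Liu21] Def 4.3/4.5 for the characters carrying `Ψ` — that identification (a convention check against Def 4.5,
p0018 L66/L68) stays with the dictionary owners (GAPS pv01-G1c, pv14-G1 (iv)).
-/
import Mathlib.NumberTheory.NumberField.CMField
import Mathlib.NumberTheory.NumberField.InfinitePlace.Embeddings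
import Summits.HodgeConjecture.HodgeCM.CM.Lemmas

set_option autoImplicit false

/-!
# The reflex-inflated type `Φ(Ψ) = {ι₁ ∘ g : g ∈ Aut L, ι₁ ∘ g⁻¹ ∘ j ∈ Ψ}`

For CM fields `K`, `L`, a ring map `j : K →+* L`, an embedding `ι₁ : L →+* ℂ` with `L/ℚ` Galois, and a CM type `Ψ` of `K`:
in the notation of [Y1neg] §6 (kernel handle `HodgeCM.PerL34.ReflexWelldef.aSet`), with `ℚ̄`-embeddings read inside `ℂ` via
`ι₁` and `φ^h = ι₁ ∘ j`, the set `A_Ψ = {τ : τ⁻¹ φ^h ∈ Ψ}` restricted to `L` is `{ι₁ ∘ g : ι₁ ∘ g⁻¹ ∘ j ∈ Ψ}` — the inflation to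
`L ⊇ K*_Ψ` of the reflex type `Ψ*`.  We prove: (1) every embedding of `L` is `ι₁ ∘ g` for a unique automorphism `g`
(Mathlib `NumberField.ComplexEmbedding.exists_comp_symm_eq_of_comp_eq`); (2) complex conjugation of the CM field `L` is
central in `Aut L` and intertwines every embedding (Mathlib `NumberField.IsCMField.complexEmbedding_complexConj`);
(3) hence `Φ(Ψ)` satisfies the CM-type axiom `τ ∈ Φ ↔ τ̄ ∉ Φ`; (4) `ι₁ ∈ Φ(Ψ) ↔ ι₁ ∘ j ∈ Ψ`.
-/

noncomputable section

namespace HodgeCM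

open NumberField NumberField.ComplexEmbedding
open Literature.AlgebraicGeometry.Motives (CMType)

namespace CMTypeOps

variable {K L : CMField}

/-- Complex conjugation of the CM field `L`, as a ring automorphism. -/
def conjAut (L : CMField) : L ≃+* L := (IsCMField.complexConj L).toRingEquiv

/-- (Ported verbatim from the HodgeCMPerL package; no docstring in the source.) -/
theorem apply_conjAut (φ : L →+* ℂ) (x : L) : φ (conjAut L x) = starRingEnd ℂ (φ x) :=
  IsCMField.complexEmbedding_complexConj L φ x

/-- (Ported verbatim from the HodgeCMPerL package; no docstring in the source.) -/
theorem comp_conjAut (φ : L →+* ℂ) : φ.comp (conjAut L).toRingHom = conjugate φ := by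
  ext x
  simp [apply_conjAut]

/-- (Ported verbatim from the HodgeCMPerL package; no docstring in the source.) -/
theorem conjAut_conjAut (x : L) : conjAut L (conjAut L x) = x := IsCMField.complexConj_apply_apply L x

/-- Complex conjugation is central in `Aut L` (seen through any embedding `ι₁`). -/
theorem conjAut_comm (ι₁ : L →+* ℂ) (h : L ≃+* L) (y : L) : conjAut L (h y) = h (conjAut L y) := by
  apply ι₁.injective
  rw [apply_conjAut]
  exact (apply_conjAut (ι₁.comp h.toRingHom) y).symm

/-- Every complex embedding of the Galois CM field `L` is `ι₁ ∘ g` for an automorphism `g`. -/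
theorem exists_eq_comp (hL : IsGalois ℚ L) (ι₁ τ : L →+* ℂ) : ∃ g : L ≃+* L, τ = ι₁.comp g.toRingHom := by
  haveI := hL
  obtain ⟨σ, hσ⟩ := exists_comp_symm_eq_of_comp_eq (k := ℚ) ι₁ τ (Subsingleton.elim _ _)
  refine ⟨(σ.symm : L ≃ₐ[ℚ] L).toRingEquiv, ?_⟩
  rw [← hσ]
  rfl

/-- … and `g` is unique. -/
theorem comp_injective (ι₁ : L →+* ℂ) {g₁ g₂ : L ≃+* L} (h : ι₁.comp g₁.toRingHom = ι₁.comp g₂.toRingHom) :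
    g₁ = g₂ :=
  RingEquiv.ext fun x => ι₁.injective (by simpa using RingHom.congr_fun h x)

/-- The underlying set of `Φ(Ψ)`. -/
def reflexInflateSet (j : K →+* L) (ι₁ : L →+* ℂ) (Ψ : CMType K) : Set (L →+* ℂ) :=
  {τ | ∃ g : L ≃+* L, τ = ι₁.comp g.toRingHom ∧ ι₁.comp (g.symm.toRingHom.comp j) ∈ Ψ.1}

/-- (Ported verbatim from the HodgeCMPerL package; no docstring in the source.) -/
theorem comp_mem_reflexInflateSet_iff (j : K →+* L) (ι₁ : L →+* ℂ) (Ψ : CMType K) (g : L ≃+* L) :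
    ι₁.comp g.toRingHom ∈ reflexInflateSet j ι₁ Ψ ↔ ι₁.comp (g.symm.toRingHom.comp j) ∈ Ψ.1 := by
  constructor
  · rintro ⟨g', hg', hmem⟩
    rwa [comp_injective ι₁ hg']
  · intro h
    exact ⟨g, rfl, h⟩

/-- The conjugate of `ι₁ ∘ g` is `ι₁ ∘ (conjAut ≫ g)`. -/
theorem conjugate_comp_eq (ι₁ : L →+* ℂ) (g : L ≃+* L) :
    conjugate (ι₁.comp g.toRingHom) = ι₁.comp ((conjAut L).trans g).toRingHom := by
  rw [← comp_conjAut]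
  rfl

/-- `ι₁ ∘ (conjAut ≫ g)⁻¹ ∘ j` is the conjugate of `ι₁ ∘ g⁻¹ ∘ j`. -/
theorem comp_symm_trans_eq (j : K →+* L) (ι₁ : L →+* ℂ) (g : L ≃+* L) :
    ι₁.comp (((conjAut L).trans g).symm.toRingHom.comp j) = conjugate (ι₁.comp (g.symm.toRingHom.comp j)) := by
  ext x
  simp only [RingHom.coe_comp, RingEquiv.toRingHom_eq_coe, RingEquiv.coe_toRingHom, Function.comp_apply,
    conjugate_coe_eq]
  change ι₁ ((conjAut L).symm (g.symm (j x))) = _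
  have h1 : (conjAut L).symm (g.symm (j x)) = conjAut L (g.symm (j x)) := by
    apply (conjAut L).injective
    rw [RingEquiv.apply_symm_apply, conjAut_conjAut]
  rw [h1, apply_conjAut]

/-- **`Φ(Ψ)` is a CM type of `L`.** -/
def reflexInflate (j : K →+* L) (ι₁ : L →+* ℂ) (hL : IsGalois ℚ L) (Ψ : CMType K) : CMType L :=
  ⟨reflexInflateSet j ι₁ Ψ, by
    intro τ
    obtain ⟨g, rfl⟩ := exists_eq_comp hL ι₁ τ
    rw [comp_mem_reflexInflateSet_iff, conjugate_comp_eq, comp_mem_reflexInflateSet_iff, comp_symm_trans_eq,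
      CMTypeOps.conjugate_mem_iff_notMem, not_not]⟩

/-- (Ported verbatim from the HodgeCMPerL package; no docstring in the source.) -/
theorem mem_reflexInflate_iff (j : K →+* L) (ι₁ : L →+* ℂ) (hL : IsGalois ℚ L) (Ψ : CMType K) (g : L ≃+* L) :
    ι₁.comp g.toRingHom ∈ (reflexInflate j ι₁ hL Ψ).1 ↔ ι₁.comp (g.symm.toRingHom.comp j) ∈ Ψ.1 :=
  comp_mem_reflexInflateSet_iff j ι₁ Ψ g

/-- **`ι₁ ∈ Φ(Ψ) ↔ ι₁ ∘ j ∈ Ψ`** (so `ι₁ ∈ Φ(Ψᵢ)` in the PerL setting by `frame_mem_of_isPerLTypes`, and in the face setting,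
`j = id`, by `admissible_mem_psi`). -/
theorem self_mem_reflexInflate_iff (j : K →+* L) (ι₁ : L →+* ℂ) (hL : IsGalois ℚ L) (Ψ : CMType K) :
    ι₁ ∈ (reflexInflate j ι₁ hL Ψ).1 ↔ ι₁.comp j ∈ Ψ.1 := by
  have h := mem_reflexInflate_iff j ι₁ hL Ψ (RingEquiv.refl L)
  simpa using h

/-- The PerL binder `IsNormalClosure ℚ K L` gives `IsGalois ℚ L` (characteristic zero). -/
theorem isGaloisRat_of_isNormalClosure (h : IsNormalClosure ℚ K L) : IsGalois ℚ L := by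
  haveI : Normal ℚ L := IsNormalClosure.normal (K := K)
  exact IsGalois.mk

end CMTypeOps

end HodgeCM

end
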